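import Summits.Ventures.LatticeQCDFlow.Scaling.DominatedStarSeparation

/-!
HONEST FRAMING: exact (Metropolis-corrected) sampling algorithms for lattice gauge theory; figures
of merit are autocorrelation/cost numbers at stated couplings and volumes; no continuum-physics
claim.

# DominatedStarDoeblin — THE DOBRUSHIN COEFFICIENT OF THE MAP-ASSISTED HOT-REFRESHED HUB: UNDER ONE-SIDED DOMINATION
# `p·μ_l(φ_r u) ≤ μ_0(u)` AND `4t ≤ p(1−t)w_0`, `d̄(n) = max_{x,y}‖Pⁿ(x,·) − Pⁿ(y,·)‖_TV ≤ ((2K+p)/p)(1 − tcp/(2m))ⁿ`,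
# SO ANY TWO INITIAL LAWS MERGE AT THAT RATE AND EVERY INITIAL LAW (NOT ONLY POINT MASSES) IS WITHIN
# `((2K+p)/p)(1 − tcp/(2m))ⁿ` OF `π̃` AT TIME `n`; PERFECT TRANSPORTS: `2(K+1)(1 − t(1−t)w_0c/(2m))ⁿ` (lean-2 GEN-26,
# ours)

Venture-side (OURS).  Cell `lqcd-flow` (pub-lqcd), unit `pub-lqcd-lean-2-g26`, 2026-08-27.  Chapter M (the
coupon-collector ceiling without perfect transports), file 15.  Setting of `Scaling/DominatedStarSeparation`.  The
whole-space Doeblin minorisation `Pⁿ(x,·) ≥ (1 − Cρⁿ)·π̃` proved there (`C = (2K+p)/p`, `ρ = 1 − tcp/(2m)`) is fed to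
Dobrushin's formula for Seneta's ergodicity coefficient (`ErgodicityCoefficient.ergodicCoeff_le_one_sub_of_minorised`,
in the tree): the `n`-step coefficient is `≤ Cρⁿ`, which is the coupling statement "two copies of the real
map-assisted hub from arbitrary starts have met, except with probability `Cρⁿ`" in its analytic form.

## What is proved

* §1 **`dominatedStar_ergodicCoeff_le`** — `τ(Pⁿ) ≤ ((2K+p)/p)(1 − tcp/(2m))ⁿ`; **`dominatedStar_worstPairTvDist_le`** —
  `d̄(n) ≤ ((2K+p)/p)(1 − tcp/(2m))ⁿ`.
* §2 **`dominatedStar_merge`** — for any two initial laws of equal mass,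
  `‖μ₀Pⁿ − ν₀Pⁿ‖_TV ≤ ((2K+p)/p)(1 − tcp/(2m))ⁿ·‖μ₀ − ν₀‖_TV`; **`dominatedStar_tvDist_lawAt_le`** — for every initial
  probability vector `μ₀` (reversible cold kernels): `‖μ₀Pⁿ − π̃‖_TV ≤ ((2K+p)/p)(1 − tcp/(2m))ⁿ`;
  `dominatedStar_tvDist_lawAt_le_of_ge_log` — `≤ ε` once `n ≥ (2m/(tcp))·log((2K+p)/(pε))`.
* §3 **`perfectStar_worstPairTvDist_le`**, **`perfectStar_tvDist_lawAt_le`** — perfect transports, `0 < t < 1`,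
  `w_0 > 0`: the same with `2(K+1)(1 − t(1−t)w_0c/(2m))ⁿ`.

Reading (no numerics implied): the regeneration argument controls the scheme uniformly in the initial law — a
tempering run started from any distribution over configurations (e.g. the output of a previous, differently tuned
run) inherits the coupon-collector guarantee with the same constants.  NOT CLAIMED: anything outside the regime
`4t ≤ p(1−t)w_0` for imperfect maps; an explicit coupling is not constructed (the analytic form is used); anything
measured.  Literature grade (cell rule): OWN RESULT on the tree's Dobrushin–Seneta toolkit
(`ErgodicityCoefficient`, `MixingTimeSubmultiplicative`); nothing cited as a fact; no new bib keys.
-/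

noncomputable section

open Finset Function
open Literature.Probability.MarkovChains

namespace Summit.Ventures.LatticeQCDFlow.Scaling

variable {S : Type*} [Fintype S] [DecidableEq S] {K m : ℕ} {μ : Fin (K + 1) → S → ℝ} {M : Fin (K + 1) → S → S → ℝ}
  {w : Fin (K + 1) → ℝ} {t p : ℝ}

section Doeblin
variable (κ : Fin m → Fin K) (φ : Fin m → Equiv.Perm S)

/-! ## §1 The `n`-step ergodicity coefficient -/

/-- **`τ(Pⁿ) ≤ ((2K+p)/p)(1 − tcp/(2m))ⁿ`:** Seneta's ergodicity (Dobrushin's) coefficient of the `n`-step kernel of the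
map-assisted hot-refreshed hub under one-sided domination and `4t ≤ p(1−t)w_0`. [ours] -/
theorem dominatedStar_ergodicCoeff_le (hm : 1 ≤ m) (ht0 : 0 ≤ t) (ht1 : t ≤ 1) (hw0 : ∀ k, 0 ≤ w k)
    (hw1 : ∑ k, w k = 1) (hμ : ∀ k x, 0 < μ k x) (hμ1 : ∀ k, ∑ u, μ k u = 1) (hM : ∀ k, IsRowStochastic (M k))
    (hM0 : ∀ u v, M 0 u v = μ 0 v) (hstat : ∀ k : Fin (K + 1), k ≠ 0 → ∀ v, ∑ u, μ k u * M k u v = μ k v)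
    (hp0 : 0 < p) (hp1 : p ≤ 1) (hdom : ∀ r u, p * μ (κ r).succ (φ r u) ≤ μ 0 u) (hreg : 4 * t ≤ p * (1 - t) * w 0)
    {c : ℕ} (hc1 : 1 ≤ c) (hc : ∀ p' : Fin K, c ≤ (univ.filter (fun r : Fin m => κ r = p')).card) (hcm : c ≤ m)
    (n : ℕ) :
    ergodicCoeff (kernelAt (fun y z : Fin (K + 1) → S =>
        t * ptGraphSwap μ (fun r : Fin m => (((0 : Fin (K + 1)), (κ r).succ) : Fin (K + 1) × Fin (K + 1))) φ y z
          + (1 - t) * prodKernel w M y z) n)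
      ≤ (2 * (K : ℝ) + p) / p * (1 - t * c * p / (2 * m)) ^ n := by
  have hP := weightedScheme_isRowStochastic (t := t) (w := w)
    (ptGraphSwap_isRowStochastic (e := fun r : Fin m => (((0 : Fin (K + 1)), (κ r).succ) : Fin (K + 1) × Fin (K + 1)))
      (φ := φ) hμ) hM hw0 hw1 ht0 ht1
  have h := ergodicCoeff_le_one_sub_of_minorised (kernelAt_isRowStochastic hP n) (sum_tensorFun_eq_one _ hμ1)
    (dominatedStar_kernelAt_ge κ φ hm ht0 ht1 hw0 hw1 hμ hμ1 hM hM0 hstat hp0 hp1 hdom hreg hc1 hc hcm n)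
  linarith

/-- **THE DOBRUSHIN COEFFICIENT: `d̄(n) = max_{x,y}‖Pⁿ(x,·) − Pⁿ(y,·)‖_TV ≤ ((2K+p)/p)(1 − tcp/(2m))ⁿ`.** [ours] -/
theorem dominatedStar_worstPairTvDist_le (hm : 1 ≤ m) (ht0 : 0 ≤ t) (ht1 : t ≤ 1) (hw0 : ∀ k, 0 ≤ w k)
    (hw1 : ∑ k, w k = 1) (hμ : ∀ k x, 0 < μ k x) (hμ1 : ∀ k, ∑ u, μ k u = 1) (hM : ∀ k, IsRowStochastic (M k))
    (hM0 : ∀ u v, M 0 u v = μ 0 v) (hstat : ∀ k : Fin (K + 1), k ≠ 0 → ∀ v, ∑ u, μ k u * M k u v = μ k v)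
    (hp0 : 0 < p) (hp1 : p ≤ 1) (hdom : ∀ r u, p * μ (κ r).succ (φ r u) ≤ μ 0 u) (hreg : 4 * t ≤ p * (1 - t) * w 0)
    {c : ℕ} (hc1 : 1 ≤ c) (hc : ∀ p' : Fin K, c ≤ (univ.filter (fun r : Fin m => κ r = p')).card) (hcm : c ≤ m)
    (n : ℕ) :
    worstPairTvDist (fun y z : Fin (K + 1) → S =>
        t * ptGraphSwap μ (fun r : Fin m => (((0 : Fin (K + 1)), (κ r).succ) : Fin (K + 1) × Fin (K + 1))) φ y z
          + (1 - t) * prodKernel w M y z) n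
      ≤ (2 * (K : ℝ) + p) / p * (1 - t * c * p / (2 * m)) ^ n := by
  rw [worstPairTvDist_eq_ergodicCoeff]
  exact dominatedStar_ergodicCoeff_le κ φ hm ht0 ht1 hw0 hw1 hμ hμ1 hM hM0 hstat hp0 hp1 hdom hreg hc1 hc hcm n

/-! ## §2 Merging of arbitrary initial laws -/

/-- **MERGING: `‖μ₀Pⁿ − ν₀Pⁿ‖_TV ≤ ((2K+p)/p)(1 − tcp/(2m))ⁿ·‖μ₀ − ν₀‖_TV`** for any two initial laws of equal mass.
[ours] -/
theorem dominatedStar_merge (hm : 1 ≤ m) (ht0 : 0 ≤ t) (ht1 : t ≤ 1) (hw0 : ∀ k, 0 ≤ w k)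
    (hw1 : ∑ k, w k = 1) (hμ : ∀ k x, 0 < μ k x) (hμ1 : ∀ k, ∑ u, μ k u = 1) (hM : ∀ k, IsRowStochastic (M k))
    (hM0 : ∀ u v, M 0 u v = μ 0 v) (hstat : ∀ k : Fin (K + 1), k ≠ 0 → ∀ v, ∑ u, μ k u * M k u v = μ k v)
    (hp0 : 0 < p) (hp1 : p ≤ 1) (hdom : ∀ r u, p * μ (κ r).succ (φ r u) ≤ μ 0 u) (hreg : 4 * t ≤ p * (1 - t) * w 0)
    {c : ℕ} (hc1 : 1 ≤ c) (hc : ∀ p' : Fin K, c ≤ (univ.filter (fun r : Fin m => κ r = p')).card) (hcm : c ≤ m)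
    {μ₀ ν₀ : (Fin (K + 1) → S) → ℝ} (hmass : ∑ x, μ₀ x = ∑ x, ν₀ x) (n : ℕ) :
    tvDist (lawAt (fun y z : Fin (K + 1) → S =>
        t * ptGraphSwap μ (fun r : Fin m => (((0 : Fin (K + 1)), (κ r).succ) : Fin (K + 1) × Fin (K + 1))) φ y z
          + (1 - t) * prodKernel w M y z) μ₀ n)
      (lawAt (fun y z : Fin (K + 1) → S =>
        t * ptGraphSwap μ (fun r : Fin m => (((0 : Fin (K + 1)), (κ r).succ) : Fin (K + 1) × Fin (K + 1))) φ y z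
          + (1 - t) * prodKernel w M y z) ν₀ n)
      ≤ (2 * (K : ℝ) + p) / p * (1 - t * c * p / (2 * m)) ^ n * tvDist μ₀ ν₀ := by
  have hP := weightedScheme_isRowStochastic (t := t) (w := w)
    (ptGraphSwap_isRowStochastic (e := fun r : Fin m => (((0 : Fin (K + 1)), (κ r).succ) : Fin (K + 1) × Fin (K + 1)))
      (φ := φ) hμ) hM hw0 hw1 ht0 ht1
  have h := tvDist_lawAt_add_le_mul (fun y z : Fin (K + 1) → S =>
        t * ptGraphSwap μ (fun r : Fin m => (((0 : Fin (K + 1)), (κ r).succ) : Fin (K + 1) × Fin (K + 1))) φ y z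
          + (1 - t) * prodKernel w M y z) hmass 0 n hP
  rw [zero_add, lawAt_zero, lawAt_zero] at h
  exact h.trans (mul_le_mul_of_nonneg_right
    (dominatedStar_worstPairTvDist_le κ φ hm ht0 ht1 hw0 hw1 hμ hμ1 hM hM0 hstat hp0 hp1 hdom hreg hc1 hc hcm n)
    (tvDist_nonneg _ _))

/-- **EVERY INITIAL LAW: `‖μ₀Pⁿ − π̃‖_TV ≤ ((2K+p)/p)(1 − tcp/(2m))ⁿ`** for every probability vector `μ₀` over
configurations (reversible cold kernels, so that `π̃P = π̃`). [ours] -/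
theorem dominatedStar_tvDist_lawAt_le (hm : 1 ≤ m) (ht0 : 0 ≤ t) (ht1 : t ≤ 1) (hw0 : ∀ k, 0 ≤ w k)
    (hw1 : ∑ k, w k = 1) (hμ : ∀ k x, 0 < μ k x) (hμ1 : ∀ k, ∑ u, μ k u = 1) (hM : ∀ k, IsRowStochastic (M k))
    (hMrev : ∀ k, DetailedBalance (μ k) (M k)) (hM0 : ∀ u v, M 0 u v = μ 0 v) (hp0 : 0 < p) (hp1 : p ≤ 1)
    (hdom : ∀ r u, p * μ (κ r).succ (φ r u) ≤ μ 0 u) (hreg : 4 * t ≤ p * (1 - t) * w 0)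
    {c : ℕ} (hc1 : 1 ≤ c) (hc : ∀ p' : Fin K, c ≤ (univ.filter (fun r : Fin m => κ r = p')).card) (hcm : c ≤ m)
    {μ₀ : (Fin (K + 1) → S) → ℝ} (hμ₀ : ∀ x, 0 ≤ μ₀ x) (hμ₀1 : ∑ x, μ₀ x = 1) (n : ℕ) :
    tvDist (lawAt (fun y z : Fin (K + 1) → S =>
        t * ptGraphSwap μ (fun r : Fin m => (((0 : Fin (K + 1)), (κ r).succ) : Fin (K + 1) × Fin (K + 1))) φ y z
          + (1 - t) * prodKernel w M y z) μ₀ n) (tensorFun μ)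
      ≤ (2 * (K : ℝ) + p) / p * (1 - t * c * p / (2 * m)) ^ n := by
  have hstat : ∀ k : Fin (K + 1), k ≠ 0 → ∀ v, ∑ u, μ k u * M k u v = μ k v :=
    fun k _ v => (hMrev k).isStationary (hM k).2 v
  have hP := weightedScheme_isRowStochastic (t := t) (w := w)
    (ptGraphSwap_isRowStochastic (e := fun r : Fin m => (((0 : Fin (K + 1)), (κ r).succ) : Fin (K + 1) × Fin (K + 1)))
      (φ := φ) hμ) hM hw0 hw1 ht0 ht1
  have hst : IsStationary (tensorFun μ) (fun y z : Fin (K + 1) → S =>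
      t * ptGraphSwap μ (fun r : Fin m => (((0 : Fin (K + 1)), (κ r).succ) : Fin (K + 1) × Fin (K + 1))) φ y z
        + (1 - t) * prodKernel w M y z) :=
    (weightedScheme_detailedBalance (ptGraphSwap_detailedBalance hμ) hMrev t).isStationary hP.2
  have hπ1 := sum_tensorFun_eq_one μ hμ1
  have h := dominatedStar_merge κ φ hm ht0 ht1 hw0 hw1 hμ hμ1 hM hM0 hstat hp0 hp1 hdom hreg hc1 hc hcm
    (μ₀ := μ₀) (ν₀ := tensorFun μ) (by rw [hμ₀1, hπ1]) n
  rw [lawAt_eq_self_of_isStationary hst] at h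
  have hC : 0 ≤ (2 * (K : ℝ) + p) / p * (1 - t * c * p / (2 * m)) ^ n :=
    (worstPairTvDist_nonneg _ n).trans
      (dominatedStar_worstPairTvDist_le κ φ hm ht0 ht1 hw0 hw1 hμ hμ1 hM hM0 hstat hp0 hp1 hdom hreg hc1 hc hcm n)
  have h1 := tvDist_le_one hμ₀ (fun z => (tensorFun_pos hμ z).le) hμ₀1 hπ1
  calc _ ≤ (2 * (K : ℝ) + p) / p * (1 - t * c * p / (2 * m)) ^ n * tvDist μ₀ (tensorFun μ) := h
    _ ≤ (2 * (K : ℝ) + p) / p * (1 - t * c * p / (2 * m)) ^ n * 1 := mul_le_mul_of_nonneg_left h1 hC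
    _ = _ := mul_one _

/-- **`‖μ₀Pⁿ − π̃‖_TV ≤ ε` ONCE `n ≥ (2m/(tcp))·log((2K+p)/(pε))`**, for every initial probability vector `μ₀`
(`0 < t`). [ours] -/
theorem dominatedStar_tvDist_lawAt_le_of_ge_log (hm : 1 ≤ m) (ht0 : 0 < t) (ht1 : t ≤ 1) (hw0 : ∀ k, 0 ≤ w k)
    (hw1 : ∑ k, w k = 1) (hμ : ∀ k x, 0 < μ k x) (hμ1 : ∀ k, ∑ u, μ k u = 1) (hM : ∀ k, IsRowStochastic (M k))
    (hMrev : ∀ k, DetailedBalance (μ k) (M k)) (hM0 : ∀ u v, M 0 u v = μ 0 v) (hp0 : 0 < p) (hp1 : p ≤ 1)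
    (hdom : ∀ r u, p * μ (κ r).succ (φ r u) ≤ μ 0 u) (hreg : 4 * t ≤ p * (1 - t) * w 0)
    {c : ℕ} (hc1 : 1 ≤ c) (hc : ∀ p' : Fin K, c ≤ (univ.filter (fun r : Fin m => κ r = p')).card) (hcm : c ≤ m)
    {μ₀ : (Fin (K + 1) → S) → ℝ} (hμ₀ : ∀ x, 0 ≤ μ₀ x) (hμ₀1 : ∑ x, μ₀ x = 1)
    {ε : ℝ} (hε : 0 < ε) {n : ℕ} (hn : 2 * (m : ℝ) / (t * c * p) * Real.log ((2 * (K : ℝ) + p) / (p * ε)) ≤ n) :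
    tvDist (lawAt (fun y z : Fin (K + 1) → S =>
        t * ptGraphSwap μ (fun r : Fin m => (((0 : Fin (K + 1)), (κ r).succ) : Fin (K + 1) × Fin (K + 1))) φ y z
          + (1 - t) * prodKernel w M y z) μ₀ n) (tensorFun μ) ≤ ε := by
  have hmpos : (0 : ℝ) < m := Nat.cast_pos.mpr (by omega)
  have hcpos : (0 : ℝ) < c := Nat.cast_pos.mpr (by omega)
  have hcm' : (c : ℝ) ≤ m := by exact_mod_cast hcm
  refine (dominatedStar_tvDist_lawAt_le κ φ hm ht0.le ht1 hw0 hw1 hμ hμ1 hM hMrev hM0 hp0 hp1 hdom hreg hc1 hc hcm hμ₀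
    hμ₀1 n).trans ?_
  have ha0 : 0 < t * c * p / (2 * m) := by positivity
  have ha1 : t * c * p / (2 * m) ≤ 1 := by
    rw [div_le_one (by positivity)]
    have h1 : t * c ≤ 1 * m := by nlinarith
    nlinarith
  have hC : 0 < (2 * (K : ℝ) + p) / p := by positivity
  refine geom_le_of_ge_log ha0 ha1 hC hε ?_
  have e1 : 1 / (t * c * p / (2 * m)) = 2 * (m : ℝ) / (t * c * p) := by field_simp
  have e2 : (2 * (K : ℝ) + p) / p / ε = (2 * (K : ℝ) + p) / (p * ε) := by rw [div_div]
  rw [e1, e2]; exact hn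

/-! ## §3 Perfect transports -/

/-- **PERFECT TRANSPORTS: `d̄(n) ≤ 2(K+1)(1 − t(1−t)w_0c/(2m))ⁿ`** (`0 < t < 1`, `w_0 > 0`, any laws, maps, weights).
[ours] -/
theorem perfectStar_worstPairTvDist_le (hm : 1 ≤ m) (ht0 : 0 < t) (ht1 : t < 1) (hw0 : ∀ k, 0 ≤ w k)
    (hw00 : 0 < w 0) (hw1 : ∑ k, w k = 1) (hμ : ∀ k x, 0 < μ k x) (hμ1 : ∀ k, ∑ u, μ k u = 1)
    (hM : ∀ k, IsRowStochastic (M k)) (hM0 : ∀ u v, M 0 u v = μ 0 v)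
    (hstat : ∀ k : Fin (K + 1), k ≠ 0 → ∀ v, ∑ u, μ k u * M k u v = μ k v) (hperf : ∀ r u, μ (κ r).succ (φ r u) = μ 0 u)
    {c : ℕ} (hc1 : 1 ≤ c) (hc : ∀ p' : Fin K, c ≤ (univ.filter (fun r : Fin m => κ r = p')).card) (hcm : c ≤ m)
    (n : ℕ) :
    worstPairTvDist (fun y z : Fin (K + 1) → S =>
        t * ptGraphSwap μ (fun r : Fin m => (((0 : Fin (K + 1)), (κ r).succ) : Fin (K + 1) × Fin (K + 1))) φ y z
          + (1 - t) * prodKernel w M y z) n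
      ≤ 2 * ((K : ℝ) + 1) * (1 - t * (1 - t) * w 0 * c / (2 * m)) ^ n := by
  have hP := weightedScheme_isRowStochastic (t := t) (w := w)
    (ptGraphSwap_isRowStochastic (e := fun r : Fin m => (((0 : Fin (K + 1)), (κ r).succ) : Fin (K + 1) × Fin (K + 1)))
      (φ := φ) hμ) hM hw0 hw1 ht0.le ht1.le
  rw [worstPairTvDist_eq_ergodicCoeff]
  have h := ergodicCoeff_le_one_sub_of_minorised (kernelAt_isRowStochastic hP n) (sum_tensorFun_eq_one _ hμ1)
    (perfectStar_kernelAt_ge κ φ hm ht0 ht1 hw0 hw00 hw1 hμ hμ1 hM hM0 hstat hperf hc1 hc hcm n)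
  linarith

/-- **PERFECT TRANSPORTS, EVERY INITIAL LAW: `‖μ₀Pⁿ − π̃‖_TV ≤ 2(K+1)(1 − t(1−t)w_0c/(2m))ⁿ`** (reversible cold
kernels). [ours] -/
theorem perfectStar_tvDist_lawAt_le (hm : 1 ≤ m) (ht0 : 0 < t) (ht1 : t < 1) (hw0 : ∀ k, 0 ≤ w k) (hw00 : 0 < w 0)
    (hw1 : ∑ k, w k = 1) (hμ : ∀ k x, 0 < μ k x) (hμ1 : ∀ k, ∑ u, μ k u = 1) (hM : ∀ k, IsRowStochastic (M k))
    (hMrev : ∀ k, DetailedBalance (μ k) (M k)) (hM0 : ∀ u v, M 0 u v = μ 0 v)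
    (hperf : ∀ r u, μ (κ r).succ (φ r u) = μ 0 u)
    {c : ℕ} (hc1 : 1 ≤ c) (hc : ∀ p' : Fin K, c ≤ (univ.filter (fun r : Fin m => κ r = p')).card) (hcm : c ≤ m)
    {μ₀ : (Fin (K + 1) → S) → ℝ} (hμ₀ : ∀ x, 0 ≤ μ₀ x) (hμ₀1 : ∑ x, μ₀ x = 1) (n : ℕ) :
    tvDist (lawAt (fun y z : Fin (K + 1) → S =>
        t * ptGraphSwap μ (fun r : Fin m => (((0 : Fin (K + 1)), (κ r).succ) : Fin (K + 1) × Fin (K + 1))) φ y z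
          + (1 - t) * prodKernel w M y z) μ₀ n) (tensorFun μ)
      ≤ 2 * ((K : ℝ) + 1) * (1 - t * (1 - t) * w 0 * c / (2 * m)) ^ n := by
  have hstat : ∀ k : Fin (K + 1), k ≠ 0 → ∀ v, ∑ u, μ k u * M k u v = μ k v :=
    fun k _ v => (hMrev k).isStationary (hM k).2 v
  have hP := weightedScheme_isRowStochastic (t := t) (w := w)
    (ptGraphSwap_isRowStochastic (e := fun r : Fin m => (((0 : Fin (K + 1)), (κ r).succ) : Fin (K + 1) × Fin (K + 1)))
      (φ := φ) hμ) hM hw0 hw1 ht0.le ht1.le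
  have hst : IsStationary (tensorFun μ) (fun y z : Fin (K + 1) → S =>
      t * ptGraphSwap μ (fun r : Fin m => (((0 : Fin (K + 1)), (κ r).succ) : Fin (K + 1) × Fin (K + 1))) φ y z
        + (1 - t) * prodKernel w M y z) :=
    (weightedScheme_detailedBalance (ptGraphSwap_detailedBalance hμ) hMrev t).isStationary hP.2
  have hπ1 := sum_tensorFun_eq_one μ hμ1
  have h := tvDist_lawAt_add_le_mul (fun y z : Fin (K + 1) → S =>
        t * ptGraphSwap μ (fun r : Fin m => (((0 : Fin (K + 1)), (κ r).succ) : Fin (K + 1) × Fin (K + 1))) φ y z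
          + (1 - t) * prodKernel w M y z) (μ := μ₀) (ν := tensorFun μ) (by rw [hμ₀1, hπ1]) 0 n hP
  rw [zero_add, lawAt_zero, lawAt_zero, lawAt_eq_self_of_isStationary hst] at h
  have hC : 0 ≤ 2 * ((K : ℝ) + 1) * (1 - t * (1 - t) * w 0 * c / (2 * m)) ^ n :=
    (worstPairTvDist_nonneg _ n).trans
      (perfectStar_worstPairTvDist_le κ φ hm ht0 ht1 hw0 hw00 hw1 hμ hμ1 hM hM0 hstat hperf hc1 hc hcm n)
  have h1 := tvDist_le_one hμ₀ (fun z => (tensorFun_pos hμ z).le) hμ₀1 hπ1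
  have hW := perfectStar_worstPairTvDist_le κ φ hm ht0 ht1 hw0 hw00 hw1 hμ hμ1 hM hM0 hstat hperf hc1 hc hcm n
  calc _ ≤ worstPairTvDist _ n * tvDist μ₀ (tensorFun μ) := h
    _ ≤ 2 * ((K : ℝ) + 1) * (1 - t * (1 - t) * w 0 * c / (2 * m)) ^ n * 1 :=
        mul_le_mul hW h1 (tvDist_nonneg _ _) hC
    _ = _ := mul_one _

end Doeblin

end Summit.Ventures.LatticeQCDFlow.Scaling

end
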